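import Literature.Geometry.Lorentzian.NearKerrLeafMinkowski
import Literature.Geometry.Lorentzian.LorentzBoost
import HarnessLib

/-!
# The boosted, translated stretched hyperboloid of Minkowski space: chart, deviation, half-space

Sequel of `NearKerrLeafMinkowski.lean` and `NearKerrLeafMinkowskiDodge.lean`. The time-stretched
hyperboloid `stretchLeaf a = {y⁰ = a √(1 + |y̲|²)}` (`a = √(1 + ε)`; an `(ε, k)`-near-Kerr leaf with `0`
holes for every `ε > 0`, which outruns every inertial observer receding faster than `1/a`) is
transported here by a Poincaré motion — the pure boost `Lorentz.boostCLM v` with lab velocity `v`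
(`LorentzBoost.lean`) followed by the translation by an event `q`. This file builds the transported
flat chart `boostStretchChart a v q = q + Λ_v ∘ A_a ∘ ι` on the hyperboloidal background
`hypBackground ⊤` and records: its manifold derivative `Λ_v ∘ A_a` and its deviation from `η`, the SAME
constant `−(a² − 1) dx⁰ ⊗ dx⁰` as for the unboosted chart because `Λ_v^* η = η`
(`deviation_boostStretchChart`, `deviationCk_boostStretchChart_le`); the slab image
`boostStretchLeaf a v q = q + Λ_v(stretchLeaf a)` and its causal position — `⊆ J⁺(q)`
(`boostStretchLeaf_subset_causalFuture`) and `J⁻(leaf) = E4` (`mem_causalPast_boostStretchLeaf`); and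
the HALF-SPACE PROPERTY (`inner_spatial_sub_pos_of_mem_boostStretchLeaf`): if `a ‖v‖ ≥ 1` (allowed
with `‖v‖ < 1` since `a > 1`) every leaf point `q + Λ_v(aY, y̲)`, `Y = √(1+|y̲|²)`, satisfies
`⟪v, x̲ − q̲⟫ = γ(⟪v, y̲⟫ + aY‖v‖²) ≥ γ‖v‖(a‖v‖Y − |y̲|) > 0`, i.e. the whole leaf stays for all times
strictly in front of the spatial plane through `q̲` orthogonal to `v`; hence an observer at rest
behind that plane never meets it (`restObserver_not_mem_boostStretchLeaf`). That the transported set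
is again an `(ε, k)`-near-Kerr leaf, and the packaged consequence for the summit
`FinalStateConjecture`, are in `NearKerrLeafMinkowskiBoostedDodge.lean`.

## References

* B. O'Neill, *Semi-Riemannian geometry*, Academic Press 1983, Ch. 9, pp. 233–236 (boosts) and
  Ch. 14, p. 402 (causality of `ℝ⁴₁`). [ONeillSemiRiemannian1983]
* M. Dafermos, G. Holzegel, I. Rodnianski, M. Taylor, arXiv:2104.08222, §1 (chart/deviation
  vocabulary). [DafermosHolzegelRodnianskiTaylor2021]
-/

noncomputable section

open Set TopologicalSpace Filter Function
open scoped Manifold ContDiff Topology ENNReal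

namespace Literature.Geometry.Lorentzian

namespace Minkowski

open Lorentz

/-! ### Algebra of the boost -/

/-- `γ² ‖v‖² / (γ + 1) = γ − 1` for `‖v‖ < 1` (from `γ² (1 − ‖v‖²) = 1`; Jackson (11.19),
`(γ − 1)/β² = γ²/(γ+1)`). [cite: ONeillSemiRiemannian1983, Ch. 9, pp. 233–236] -/
theorem gamma_sq_div_mul_norm_sq {v : E3} (hv : ‖v‖ < 1) :
    gamma v ^ 2 / (gamma v + 1) * ‖v‖ ^ 2 = gamma v - 1 := by
  have h := gamma_sq_mul hv
  have h1 : 1 ≤ gamma v := one_le_gamma hv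
  have hne : gamma v + 1 ≠ 0 := by positivity
  field_simp
  nlinarith

/-- Pairing the spatial part of the boost with `v`: `⟪v, (Λ_v x)~⟫ = γ (⟪v, x̲⟫ + x⁰ ‖v‖²)`
(Jackson (11.19)). [cite: ONeillSemiRiemannian1983, Ch. 9, pp. 233–236] -/
theorem inner_spatial_boostCLM {v : E3} (hv : ‖v‖ < 1) (x : E4) :
    inner ℝ v (E4.spatial (boostCLM v x)) =
      gamma v * (inner ℝ v (E4.spatial x) + x 0 * ‖v‖ ^ 2) := by
  rw [spatial_boostCLM_apply, inner_add_right, real_inner_smul_right, real_inner_self_eq_norm_sq]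
  have h := gamma_sq_div_mul_norm_sq hv
  set γ := gamma v
  set s := inner ℝ v (E4.spatial x)
  calc s + (γ ^ 2 / (γ + 1) * s + γ * x 0) * ‖v‖ ^ 2
        = s + (γ ^ 2 / (γ + 1) * ‖v‖ ^ 2) * s + γ * x 0 * ‖v‖ ^ 2 := by ring
    _ = γ * (s + x 0 * ‖v‖ ^ 2) := by rw [h]; ring

/-- Triangle-inequality bound for the spatial part of the boost:
`‖(Λ_v x)~‖ ≤ ‖x̲‖ + |γ²/(γ+1) ⟪v, x̲⟫ + γ x⁰| ‖v‖` (from Jackson (11.19)).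
[cite: ONeillSemiRiemannian1983, Ch. 9, pp. 233–236] -/
theorem norm_spatial_boostCLM_le_add (v : E3) (x : E4) :
    ‖E4.spatial (boostCLM v x)‖ ≤
      ‖E4.spatial x‖ + |gamma v ^ 2 / (gamma v + 1) * inner ℝ v (E4.spatial x) + gamma v * x 0| *
        ‖v‖ := by
  rw [spatial_boostCLM_apply]
  refine (norm_add_le _ _).trans ?_
  rw [norm_smul, Real.norm_eq_abs]

/-- The boost is future-causal-preserving in coordinates: if `‖x̲‖ ≤ x⁰` then
`‖(Λ_v x)~‖ ≤ (Λ_v x)⁰` (`η` is preserved, `Lorentz.minkowski_boostCLM`, and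
`(Λ_v x)⁰ = γ(x⁰ + ⟪v, x̲⟫) ≥ γ(x⁰ − ‖v‖‖x̲‖) ≥ 0`). O'Neill 1983, Ch. 9, p. 234 (orthochronous boosts).
[cite: ONeillSemiRiemannian1983, Ch. 9, pp. 233–236] -/
theorem norm_spatial_boostCLM_le {v : E3} (hv : ‖v‖ < 1) {x : E4}
    (hx : ‖E4.spatial x‖ ≤ x 0) : ‖E4.spatial (boostCLM v x)‖ ≤ boostCLM v x 0 := by
  have hγ : 0 < gamma v := gamma_pos hv
  have h0 : 0 ≤ boostCLM v x 0 := by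
    rw [boostCLM_apply_zero]
    have hcs : -(‖v‖ * ‖E4.spatial x‖) ≤ inner ℝ v (E4.spatial x) :=
      neg_le_of_abs_le (abs_real_inner_le_norm v (E4.spatial x))
    have : ‖v‖ * ‖E4.spatial x‖ ≤ ‖E4.spatial x‖ :=
      mul_le_of_le_one_left (norm_nonneg _) hv.le
    exact mul_nonneg hγ.le (by linarith)
  have hη := minkowski_boostCLM hv x x
  rw [C0Extension.bilin_self_eq, C0Extension.bilin_self_eq] at hη
  have hle : ‖E4.spatial (boostCLM v x)‖ ^ 2 ≤ (boostCLM v x 0) ^ 2 := by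
    nlinarith [norm_nonneg (E4.spatial x)]
  exact (pow_le_pow_iff_left₀ (norm_nonneg _) h0 two_ne_zero).1 hle

/-! ### The boosted, translated stretched chart -/

/-- The affine map `y ↦ q + Λ_v (A_a y)` of `E4` (Poincaré motion after the time stretch).
O'Neill 1983, Ch. 9, pp. 233–236. [cite: ONeillSemiRiemannian1983, Ch. 9, pp. 233–236] -/
def boostStretchAffine (a : ℝ) (v : E3) (q : E4) : E4 → E4 :=
  fun y => q + boostCLM v (timeStretch a y)

/-- Unfolding of `boostStretchAffine`. [folklore] -/
@[simp]
theorem boostStretchAffine_apply (a : ℝ) (v : E3) (q : E4) (y : E4) :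
    boostStretchAffine a v q y = q + boostCLM v (timeStretch a y) := rfl

/-- `boostStretchAffine` is a constant plus a continuous linear map. [folklore] -/
theorem boostStretchAffine_eq (a : ℝ) (v : E3) (q : E4) :
    boostStretchAffine a v q = fun y => q + ((boostCLM v).comp (timeStretch a)) y := rfl

/-- `boostStretchAffine` is `C^∞`. [folklore] -/
theorem contDiff_boostStretchAffine (a : ℝ) (v : E3) (q : E4) :
    ContDiff ℝ ∞ (boostStretchAffine a v q) := by
  rw [boostStretchAffine_eq]
  exact contDiff_const.add ((boostCLM v).comp (timeStretch a)).contDiff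

/-- The Fréchet derivative of `boostStretchAffine` is `Λ_v ∘ A_a` at every point. [folklore] -/
theorem fderiv_boostStretchAffine (a : ℝ) (v : E3) (q : E4) (y : E4) :
    fderiv ℝ (boostStretchAffine a v q) y = (boostCLM v).comp (timeStretch a) := by
  rw [boostStretchAffine_eq, fderiv_const_add, ContinuousLinearMap.fderiv]

/-- The **boosted, translated stretched flat chart** `Ψ = q + Λ_v ∘ A_a ∘ ι : ⊤ → E4` of the
Minkowski development on the hyperboloidal background `hypBackground ⊤` (DHRT arXiv:2104.08222, §1).
[cite: DafermosHolzegelRodnianskiTaylor2021, §1] -/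
def boostStretchChart (a : ℝ) (v : E3) (q : E4) : (hypBackground ⊤).domain → E4 :=
  fun x => boostStretchAffine a v q x.1

/-- Unfolding: `boostStretchChart a v q x = q + Λ_v (A_a x)`. [folklore] -/
@[simp]
theorem boostStretchChart_apply (a : ℝ) (v : E3) (q : E4) (x : (hypBackground ⊤).domain) :
    boostStretchChart a v q x = q + boostCLM v (timeStretch a x.1) := rfl

/-- The boosted stretched chart is `C^∞`. [folklore] -/
theorem contMDiff_boostStretchChart (a : ℝ) (v : E3) (q : E4) :
    ContMDiff 𝓘(ℝ, E4) (𝓡 4) ∞ (boostStretchChart a v q) :=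
  (contDiff_boostStretchAffine a v q).contMDiff.comp contMDiff_subtype_val

/-- The manifold derivative of the boosted stretched chart is `Λ_v ∘ A_a`. [folklore] -/
theorem mfderiv_boostStretchChart_apply (a : ℝ) (v : E3) (q : E4) (x : (hypBackground ⊤).domain)
    (w : E4) :
    mfderiv 𝓘(ℝ, E4) 𝓘(ℝ, E4) (boostStretchChart a v q) x w = boostCLM v (timeStretch a w) := by
  have hval : MDifferentiableAt 𝓘(ℝ, E4) 𝓘(ℝ, E4)
      (Subtype.val : (hypBackground ⊤).domain → E4) x :=
    (contMDiff_subtype_val (n := 1)).mdifferentiableAt one_ne_zero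
  have hdiff : DifferentiableAt ℝ (boostStretchAffine a v q) x.1 :=
    ((contDiff_boostStretchAffine a v q).differentiable (by simp)).differentiableAt
  have hA : MDifferentiableAt 𝓘(ℝ, E4) 𝓘(ℝ, E4) (boostStretchAffine a v q) x.1 :=
    mdifferentiableAt_iff_differentiableAt.mpr hdiff
  have hcomp : boostStretchChart a v q =
      (boostStretchAffine a v q) ∘ (Subtype.val : (hypBackground ⊤).domain → E4) := rfl
  rw [hcomp, mfderiv_comp_apply x hA hval, mfderiv_eq_fderiv, fderiv_boostStretchAffine,
    OpensChart.mfderiv_subtypeVal_apply]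
  rfl

/-- The metric deviation of the boosted stretched chart from `η` is the constant form
`−(a² − 1) dx⁰ ⊗ dx⁰` (the boost preserves `η`). [folklore] -/
theorem deviation_boostStretchChart (a : ℝ) {v : E3} (hv : ‖v‖ < 1) (q : E4)
    (x : (hypBackground ⊤).domain) :
    vacuumCauchyDevelopment.toSpacetime.deviation (hypBackground ⊤) (boostStretchChart a v q) x =
      stretchDefect a := by
  ext u w
  rw [Spacetime.deviation_apply, stretchDefect_apply]
  change bilin (mfderiv 𝓘(ℝ, E4) 𝓘(ℝ, E4) (boostStretchChart a v q) x u)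
      (mfderiv 𝓘(ℝ, E4) 𝓘(ℝ, E4) (boostStretchChart a v q) x w) - bilin u w = _
  rw [mfderiv_boostStretchChart_apply, mfderiv_boostStretchChart_apply, minkowski_boostCLM hv]
  exact bilin_timeStretch_sub a u w

/-- Hence the zero-extended deviation of the boosted stretched chart is that constant on `E4`.
[folklore] -/
theorem deviationExtend_boostStretchChart (a : ℝ) {v : E3} (hv : ‖v‖ < 1) (q : E4) :
    vacuumCauchyDevelopment.toSpacetime.deviationExtend (hypBackground ⊤) (boostStretchChart a v q) =
      fun _ => stretchDefect a := by
  funext y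
  have h := vacuumCauchyDevelopment.toSpacetime.deviationExtend_coe (hypBackground ⊤)
    (boostStretchChart a v q) ⟨y, trivial⟩
  rw [deviation_boostStretchChart a hv] at h
  exact h

/-- **The `Cᵏ` deviation of the boosted stretched chart is at most `|a² − 1|`** on every slab.
[folklore] -/
theorem deviationCk_boostStretchChart_le (a : ℝ) {v : E3} (hv : ‖v‖ < 1) (q : E4) (k : ℕ)
    (τ : ℝ) :
    vacuumCauchyDevelopment.toSpacetime.deviationCk (hypBackground ⊤) (boostStretchChart a v q) k τ ≤
      ENNReal.ofReal |a ^ 2 - 1| := by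
  rw [Spacetime.deviationCk, deviationExtend_boostStretchChart a hv]
  refine (supCkENorm_const_le _ k _).trans ?_
  rw [← ofReal_norm]
  exact ENNReal.ofReal_le_ofReal (norm_stretchDefect_le a)

/-! ### The boosted stretched leaf -/

/-- The **boosted, translated stretched leaf** `q + Λ_v({y⁰ = a √(1+|y̲|²)})`: the slab image of the
boosted stretched chart. O'Neill 1983, Ch. 14, p. 402. [cite: ONeillSemiRiemannian1983, Ch. 14, p. 402] -/
def boostStretchLeaf (a : ℝ) (v : E3) (q : E4) : Set E4 :=
  boostStretchChart a v q '' (hypBackground ⊤).timeSlab 0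

/-- The points `q + Λ_v (a √(1+‖y‖²), y)` lie on the boosted stretched leaf. [folklore] -/
theorem add_boostCLM_ofTimeSpace_mem_boostStretchLeaf (a : ℝ) (v : E3) (q : E4) (y : E3) :
    q + boostCLM v (E4.ofTimeSpace (a * √(1 + ‖y‖ ^ 2)) y) ∈ boostStretchLeaf a v q := by
  refine ⟨⟨E4.ofTimeSpace (√(1 + ‖y‖ ^ 2)) y, trivial⟩, ?_, ?_⟩
  · rw [ModelBackground.mem_timeSlab, hypTime_eq]
    simp
  · rw [boostStretchChart_apply, timeStretch_ofTimeSpace]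

/-- Points of the boosted stretched leaf are `q + Λ_v (a √(1+‖y‖²), y)` for some `y ∈ E3`.
[folklore] -/
theorem exists_of_mem_boostStretchLeaf {a : ℝ} {v : E3} {q z : E4}
    (hz : z ∈ boostStretchLeaf a v q) :
    ∃ y : E3, z = q + boostCLM v (E4.ofTimeSpace (a * √(1 + ‖y‖ ^ 2)) y) := by
  obtain ⟨x, hx, rfl⟩ := hz
  rw [ModelBackground.mem_timeSlab, hypTime_eq, sub_eq_zero] at hx
  refine ⟨E4.spatial x.1, ?_⟩
  rw [boostStretchChart_apply]
  congr 2
  rw [← hx, ← timeStretch_ofTimeSpace]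
  congr 1
  exact (E4.ofTimeSpace_time_spatial x.1).symm

/-- **The boosted stretched leaf lies in `J⁺(q)`** (for `a ≥ 1`, `‖v‖ < 1`): the stretched leaf point
`(aY, y)`, `Y = √(1+|y|²) ≥ |y|`, is future-causal from the origin and the boost preserves that.
O'Neill 1983, Ch. 14, p. 402. [cite: ONeillSemiRiemannian1983, Ch. 14, p. 402] -/
theorem boostStretchLeaf_subset_causalFuture {a : ℝ} (ha : 1 ≤ a) {v : E3} (hv : ‖v‖ < 1)
    (q : E4) :
    boostStretchLeaf a v q ⊆ vacuumCauchyDevelopment.metric.causalFuture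
      vacuumCauchyDevelopment.timeOrientation ({q} : Set E4) := by
  intro z hz
  obtain ⟨y, rfl⟩ := exists_of_mem_boostStretchLeaf hz
  refine mem_causalFuture_vacuumCauchyDevelopment ?_
  rw [map_add, add_sub_cancel_left, PiLp.add_apply, add_sub_cancel_left]
  refine norm_spatial_boostCLM_le hv ?_
  rw [E4.spatial_ofTimeSpace, E4.ofTimeSpace_apply_zero]
  have h1 : ‖y‖ ≤ √(1 + ‖y‖ ^ 2) := (le_abs_self _).trans (abs_le_sqrt_one_add_sq ‖y‖)
  have h2 : 0 ≤ √(1 + ‖y‖ ^ 2) := Real.sqrt_nonneg _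
  nlinarith

/-- **The boosted stretched leaf lies in an open half-space.** If `a ‖v‖ ≥ 1` (`‖v‖ < 1` is allowed
since `a > 1`), every point `z = q + Λ_v(aY, y)`, `Y = √(1+|y|²)`, of `q + Λ_v({y⁰ = a√(1+|y̲|²)})` has
`⟪v, z̲ − q̲⟫ = γ (⟪v, y⟫ + aY ‖v‖²) ≥ γ ‖v‖ (a‖v‖ Y − ‖y‖) > 0` (`inner_spatial_boostCLM`,
Cauchy–Schwarz, `a‖v‖Y ≥ Y > ‖y‖`): the whole leaf stays, at all times, strictly on the forward side of
the spatial plane through `q̲` orthogonal to `v` — it never visits the closed half-space behind it.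
O'Neill 1983, Ch. 9, pp. 233–236; Ch. 14, p. 402. [cite: ONeillSemiRiemannian1983, Ch. 14, p. 402] -/
theorem inner_spatial_sub_pos_of_mem_boostStretchLeaf {a : ℝ} {v : E3} (hv : ‖v‖ < 1)
    (hav : 1 ≤ a * ‖v‖) {q z : E4} (hz : z ∈ boostStretchLeaf a v q) :
    0 < inner ℝ v (E4.spatial z - E4.spatial q) := by
  obtain ⟨y, rfl⟩ := exists_of_mem_boostStretchLeaf hz
  set Y : ℝ := √(1 + ‖y‖ ^ 2) with hY
  rw [map_add, add_sub_cancel_left, inner_spatial_boostCLM hv, E4.spatial_ofTimeSpace,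
    E4.ofTimeSpace_apply_zero]
  have hγ : 0 < gamma v := gamma_pos hv
  have hcs : -(‖v‖ * ‖y‖) ≤ inner ℝ v y := neg_le_of_abs_le (abs_real_inner_le_norm v y)
  have hv0 : 0 < ‖v‖ := by
    rcases (norm_nonneg v).eq_or_lt with h | h
    · rw [← h, mul_zero] at hav
      linarith
    · exact h
  have hYy : ‖y‖ < Y := (Real.lt_sqrt (norm_nonneg _)).2 (by nlinarith)
  have hY0 : 0 < Y := (norm_nonneg _).trans_lt hYy
  -- `aY‖v‖ ≥ Y > ‖y‖`, so `⟪v, y⟫ + aY‖v‖² ≥ ‖v‖ (aY‖v‖ − ‖y‖) > 0`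
  have h3 : Y ≤ a * Y * ‖v‖ := by nlinarith
  have h4 : 0 < ‖v‖ * (a * Y * ‖v‖ - ‖y‖) := mul_pos hv0 (by linarith)
  refine mul_pos hγ ?_
  nlinarith

/-- **Dodging an observer at rest.** If `a ‖v‖ ≥ 1` and the rest position `x̲_obs` satisfies
`⟪v, x̲_obs − q̲⟫ ≤ 0`, then NO event `(t, x̲_obs)` of the observer's world-line lies on the boosted
stretched leaf (immediate from the half-space property). O'Neill 1983, Ch. 14, p. 402.
[cite: ONeillSemiRiemannian1983, Ch. 14, p. 402] -/
theorem restObserver_not_mem_boostStretchLeaf {a : ℝ} {v : E3} (hv : ‖v‖ < 1) (hav : 1 ≤ a * ‖v‖)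
    {q : E4} {x_obs : E3} (hq : inner ℝ v (x_obs - E4.spatial q) ≤ 0) (t : ℝ) :
    E4.ofTimeSpace t x_obs ∉ boostStretchLeaf a v q := by
  intro hmem
  have h := inner_spatial_sub_pos_of_mem_boostStretchLeaf hv hav hmem
  rw [E4.spatial_ofTimeSpace] at h
  linarith

/-- `A_a (c ∂₀) = (a c) ∂₀`. [folklore] -/
theorem timeStretch_smul_basisVector (a c : ℝ) :
    timeStretch a (c • E4.basisVector 0) = (a * c) • E4.basisVector 0 := by
  rw [timeStretch_apply, C0Extension.smul_basisVector_apply_zero, ← add_smul]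
  ring_nf

/-- **Every point of Minkowski space lies in the causal past of the boosted stretched leaf**
(`1 < a`, `‖v‖ < 1`): with a unit `ê`, `⟪v, ê⟫ = ‖v‖`, the leaf point `q + Λ_v(aY, ρ ê)`,
`Y = √(1+ρ²)`, has time `q⁰ + γ(aY + ρ‖v‖)` and spatial part within `γρ + γ a Y ‖v‖` of `q̲`
(`γ²‖v‖²/(γ+1) = γ − 1`), and `γ(aY + ρ‖v‖) − (γρ + γaY‖v‖) = γ(1 − ‖v‖)(aY − ρ) ≥ γ(1−‖v‖)(a−1)ρ`,
which dominates `‖q̲ − z̲‖ + |z⁰ − q⁰|` for `ρ` large. So `J⁻(S) = E4` and the barrier clause of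
`IsNearKerrLeaf` holds trivially. O'Neill 1983, Ch. 14, p. 402. [cite: ONeillSemiRiemannian1983, Ch. 14, p. 402] -/
theorem mem_causalPast_boostStretchLeaf {a : ℝ} (ha : 1 < a) {v : E3} (hv : ‖v‖ < 1) (q z : E4) :
    z ∈ (vacuumCauchyDevelopment.metric.causalPast vacuumCauchyDevelopment.timeOrientation
      (boostStretchLeaf a v q) : Set E4) := by
  have hγ : 0 < gamma v := gamma_pos hv
  -- a unit vector `ê` with `⟪v, ê⟫ = ‖v‖`
  obtain ⟨e, he1, hve⟩ : ∃ e : E3, ‖e‖ = 1 ∧ inner ℝ v e = ‖v‖ := by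
    by_cases hv0 : v = 0
    · refine ⟨EuclideanSpace.single (0 : Fin 3) (1 : ℝ), by simp, ?_⟩
      rw [hv0, inner_zero_left, norm_zero]
    · refine ⟨‖v‖⁻¹ • v, ?_, ?_⟩
      · rw [norm_smul, norm_inv, norm_norm, inv_mul_cancel₀ (norm_ne_zero_iff.2 hv0)]
      · rw [real_inner_smul_right, real_inner_self_eq_norm_sq]
        field_simp
  set C : ℝ := ‖E4.spatial q - E4.spatial z‖ + |z 0 - q 0| with hC
  have hC0 : 0 ≤ C := by positivity
  have hden : 0 < gamma v * (1 - ‖v‖) * (a - 1) := by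
    have : 0 < 1 - ‖v‖ := by linarith
    have : 0 < a - 1 := by linarith
    positivity
  set ρ : ℝ := C / (gamma v * (1 - ‖v‖) * (a - 1)) with hρ
  have hρ0 : 0 ≤ ρ := div_nonneg hC0 hden.le
  have hρC : gamma v * (1 - ‖v‖) * (a - 1) * ρ = C := by
    rw [hρ, mul_div_cancel₀ _ hden.ne']
  set Y : ℝ := √(1 + ‖ρ • e‖ ^ 2) with hY
  have hnρe : ‖ρ • e‖ = ρ := by
    rw [norm_smul, he1, mul_one, Real.norm_eq_abs, abs_of_nonneg hρ0]
  have hYρ : ρ ≤ Y := by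
    rw [hY, hnρe]; exact (le_abs_self ρ).trans (abs_le_sqrt_one_add_sq ρ)
  have hY0 : 0 ≤ Y := hρ0.trans hYρ
  set sP : E4 := q + boostCLM v (E4.ofTimeSpace (a * Y) (ρ • e)) with hsP
  have hsS : sP ∈ boostStretchLeaf a v q := add_boostCLM_ofTimeSpace_mem_boostStretchLeaf a v q _
  refine LorentzianMetric.causalFuture_mono (g := vacuumCauchyDevelopment.metric)
    (singleton_subset_iff.2 hsS) (mem_causalPast_vacuumCauchyDevelopment ?_)
  -- time and spatial parts of the leaf point
  have hin : inner ℝ v (ρ • e) = ρ * ‖v‖ := by rw [real_inner_smul_right, hve]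
  have ht : sP 0 = q 0 + gamma v * (a * Y + ρ * ‖v‖) := by
    rw [hsP, PiLp.add_apply, boostCLM_apply_zero, E4.ofTimeSpace_apply_zero,
      E4.spatial_ofTimeSpace, hin]
  have hspn : ‖E4.spatial sP - E4.spatial z‖ ≤
      ‖E4.spatial q - E4.spatial z‖ + ((gamma v - 1) * ρ + gamma v * (a * Y) * ‖v‖ + ρ) := by
    have h1 : E4.spatial sP - E4.spatial z =
        (E4.spatial q - E4.spatial z) +
          E4.spatial (boostCLM v (E4.ofTimeSpace (a * Y) (ρ • e))) := by
      rw [hsP, map_add]; abel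
    rw [h1]
    refine (norm_add_le _ _).trans (add_le_add le_rfl ?_)
    refine (norm_spatial_boostCLM_le_add v _).trans ?_
    rw [E4.spatial_ofTimeSpace, E4.ofTimeSpace_apply_zero, hnρe, hin]
    have hcoef : 0 ≤ gamma v ^ 2 / (gamma v + 1) * (ρ * ‖v‖) + gamma v * (a * Y) := by
      positivity
    rw [abs_of_nonneg hcoef]
    have hg := gamma_sq_div_mul_norm_sq hv
    have : (gamma v ^ 2 / (gamma v + 1) * (ρ * ‖v‖) + gamma v * (a * Y)) * ‖v‖ =
        (gamma v ^ 2 / (gamma v + 1) * ‖v‖ ^ 2) * ρ + gamma v * (a * Y) * ‖v‖ := by ring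
    rw [this, hg]
    linarith
  rw [ht]
  -- `γ(aY + ρ‖v‖) − (γρ + γaY‖v‖) = γ(1 − ‖v‖)(aY − ρ) ≥ γ(1−‖v‖)(a−1)ρ = C`
  have hkey : ‖E4.spatial q - E4.spatial z‖ + ((gamma v - 1) * ρ + gamma v * (a * Y) * ‖v‖ + ρ) ≤
      q 0 + gamma v * (a * Y + ρ * ‖v‖) - z 0 := by
    have hz : z 0 - q 0 ≤ |z 0 - q 0| := le_abs_self _
    have hY' : (a - 1) * ρ ≤ a * Y - ρ := by nlinarith
    have h2 : gamma v * (1 - ‖v‖) * ((a - 1) * ρ) ≤ gamma v * (1 - ‖v‖) * (a * Y - ρ) :=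
      mul_le_mul_of_nonneg_left hY' (by nlinarith)
    nlinarith
  exact hspn.trans hkey

end Minkowski

end Literature.Geometry.Lorentzian

end
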